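import Summits.SmoothPoincare4.SmoothPoincare4.Theorems.WeakReductionDescentDependentTripleGenusThreeStandard
import Summits.SmoothPoincare4.SmoothPoincare4.Theorems.WeakReductionDescentDependentTripleGenusThreeStandardStubBoundsDiscOfAnnularChart
import Summits.SmoothPoincare4.SmoothPoincare4.Theorems.DependentTripleGenusThreeStandard.Negative.SketchStubsTightness
import Literature.Topology.FourManifolds.DependentTripleGenusThreeTrisectionsProofs
import Literature.Topology.FourManifolds.LoopSurgeryHomotopySphereGKProofs
import Literature.Barriers.SmoothPoincare4.LowGenusTrisectionsStandardOfClassification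
import Literature.Barriers.SmoothPoincare4.WeaklyReducibleGenusThreeStandard
import Literature.Topology.FourManifolds.LargeKTrisectionClassification
import Literature.Topology.FourManifolds.SphereTrisectionsSectors
import Literature.Topology.FourManifolds.TrisectionsProofs
import Literature.Topology.FourManifolds.TrisectionsStabilization
import Literature.Topology.FourManifolds.TrisectionFunctorGKCentralSurface
import Literature.Topology.FourManifolds.HomotopyS4OrientableProofs
import Literature.Topology.FourManifolds.HomotopyS4CompactProofs
import Literature.Topology.FourManifolds.SphereSimplyConnected
import Literature.Topology.FourManifolds.ConnectedSumSummands
import Literature.Topology.FourManifolds.ConnectedSumTransportProofs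
import Literature.Topology.FourManifolds.CircleSurgery

/-!
# Disproof of `DependentTripleGenusThreeStandard` (X_F, stmt-SmoothPoincare4-18000) — findings:
# NO KILL short of `¬ SmoothPoincare4` (crux and stubs 1, 4 of the picked line `Sketch` are
# SPC4-implied); the two UNSHIELDED stubs (2 = Meier–Schirmer–Zupan Thm 1.2, 3 = Aranda–Zupan
# Lemma 3.8) are printed theorems, transcribed faithfully; stub 2 is TIGHT — its misprinted form
# (`k′ = max`) and its range relaxed by one (`k₀ ≥ g − 2`) are both REFUTED here, sorry-free, on
# the round `S⁴` (LANDED: `Theorems/DependentTripleGenusThreeStandard/Negative/SketchStubsTightness.lean`,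
# p169239); for stub 3 (v2 AND skeleton v7's `…_of_noAnnularChart01`) the hypothesis `e : M ≃ₕ S⁴`
# is decoration, v7's form is implied by the `e`-free Lemma 3.8 and its "not co-annular" clause is
# redundant given the landed stub 3a (p168238) — all PROVED below; skeleton v7 re-checked: rc 0,
# exactly the 4 registered stubs sorried, composition closed modulo them (no smuggled gap)
# (cdisprove seat refuter-cdisprove-stmt-SmoothPoincare4-18000-0, cycle 1, 2026-08-17)

X_F (`Theses.WeakReductionDescent.DependentTripleGenusThreeStandard`): a smooth `M ≃ₕ S⁴` (bare
binders) with a genus-`3` Gay–Kirby trisection admitting a DEPENDENT TRIPLE is `≅ S⁴` — verbatim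
(`Iff.rfl`, `Theorems.dependentTripleGenusThreeStandard_iff_arandaZupan`) the vendored named fact
`Literature.Topology.FourManifolds.arandaZupan_dependentTriple_genusThree_homotopySphere`
(Aranda–Zupan, arXiv:2503.04607, Thm 1.4 / Cor 1.5, p. 2; proof §7 pp. 24–26).

Read first, not repeated here: the birth attack `Cruxes/DependentTripleGenusThreeStandard/BirthAttack.lean`
(refuter-rattack, sorry-free): elaboration rc 0 and symbol-by-symbol readback, SHIELD at every genus
(`BirthAttack.shield`, `dependentTripleStandardAt_of_spc4`), kill criterion (`exotic_of_not`: an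
exotic `S⁴` of trisection genus `≤ 3`), restates-summit probes, the type identity `Σ kᵢ = 3`
(`sum_k_eq_three`, `type_dichotomy`), faithfulness to the held text pp. 2, 6, 24–26, and the paper
mutation analysis (`e` load-bearing: `#³(S¹ × S³)`, `S_p`; triple / genus mutations shielded).

## What THIS file adds (kernel-checked unless marked "paper")

* §0 `not_spc4_of_not` — the refutation cost of the crux, through the LANDED prover theorem
  `Theorems.dependentTripleGenusThreeStandard_of_smoothPoincare` (one line; no second proof).
* §A LOAD-BEARING ANALYSIS of the crux, completing the birth attack:
  - `WithoutHomotopyEquiv` (drop `e`): UNSHIELDED and FALSE IN PRINT with the smaller witness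
    `S¹ × S³` (paper): its `(3; 2,2,1)`-trisection `(S¹×S³)(1;1,1,1) # S⁴(1;1,0,0) # S⁴(1;0,1,0)`
    carries the case-(1) dependent triple `(α₁, push-off of β₁ = α₁, γ₃)` (AZ25 §7 p. 24) and
    `π₁ = ℤ`.  Formal shadow: `withoutHomotopyEquiv_false_of_nonSimplyConnectedCarrier` — ¬ it,
    MODULO the construction `NonSimplyConnectedCarrier` (a non-simply-connected closed `X` with a
    genus-3 GK-trisection and a dependent triple; printed witness `S¹ × S³`; not constructible in
    the tree: no diagram ↔ `IsGKTrisection` correspondence with explicit compressing discs).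
  - `WithoutTriple` (drop the dependent triple, keep genus 3) = "genus-3-trisected homotopy spheres
    are standard" = MSZ16 + the open `(3;1,1,1)` frontier (`LowGenusTrisectionBarrier`'s first open
    type): SHIELDED (`withoutTriple_of_spc4`), so the triple carries METHOD, not truth value.
  - `WithoutNonSep` (allow inessential curves in the triple): SHIELDED (`withoutNonSep_of_spc4`);
    on paper it is EQUIVALENT to `WithoutTriple` (three tiny inessential circles in `F`, capped by
    discs pushed into `H 0, H 1, H 2`, form a "triple" whose union separates `F`) — so
    `NonSep` is what makes Thm 1.4 a theorem rather than the open frontier.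
* §B THE PICKED LINE `Sketch` (`Lines/Sketch.lean`, 4 registered stubs, composition
  `Sketch.DependentTripleGenusThreeStandard_of` sorry-free modulo the stubs — joint sufficiency has
  no gap; this file restates each stub VERBATIM as a `def` and proves what can be proved ABOUT it):
  - Stub 1 `stub_weaklyReducibleStandard` = `az2025_weaklyReducible_genusThree_homotopySphere_gk.{0}`:
    SHIELDED (`stub1_of_spc4`, via the tree's `…_of_smoothPoincare`).  Not killable.
  - Stub 2 `stub_mszClassification` = `msz_trisection_classification_gk.{0}` (MSZ16 Thm 1.2 with
    `k′ = min{k₁, k₂}` — the tree's correction of the printed `max`): UNSHIELDED (it classifies ALL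
    closed 4-manifolds in the range `k₀ ≥ g − 1`), printed, transcribed faithfully (checked: for a
    connected sum of genus-one trisections with `k₀ + 1 ≥ g` the number of `S¹ × S³` summands is
    `min{k₁, k₂}`, module docstring of `LargeKTrisectionClassification.lean`).  TIGHTNESS, PROVED:
    `stub_mszClassification_false_with_max` — the statement with the PRINTED `k′ = max{k₁, k₂}` is
    FALSE: the `(1; 0,1,0)`-stabilisation of Gay–Kirby's genus-`0` trisection of the round `S⁴`
    (`sphere_genusZero_gkTrisection_holds` + `IsGKTrisection.exists_stabilizeOne`, both PROVED)
    has `g = 1 = k₀ + 1` and `max{k₁, k₂} = 1`, but `S⁴` is neither `#¹(S¹ × S³)` nor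
    `M # ℂP²` with `M = M₀ # (S¹ × S³)` (`π₁`: `IsCircleProdSum.not_simplyConnectedSpace_succ`,
    `IsConnectedSum.simplyConnectedSpace_left`, `simplyConnectedSpace_sphere_four_holds`, PROVED);
    `stub_mszClassification_false_with_relaxed_range` — the range `k₀ + 1 ≥ g` cannot be widened
    to `k₀ + 2 ≥ g`: the `(3; 1,1,1)`-stabilisation of the genus-`0` trisection of `S⁴`
    (`IsGKTrisection.exists_stabilization`, PROVED) has `min{k₁, k₂} = 1`.  So any proof of stub 2
    must USE `k₀ + 1 ≥ g` and must PRODUCE `min`; and the `(3;1,1,1)` type of this route is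
    certified (in the kernel, not only in print) to lie outside every MSZ-type classification.
    (The homotopy-sphere COROLLARY with the widened range stays SPC4-shielded — only the
    classification-with-list form is refuted.)
  - Stub 3 `stub_separatingPairReducing` = AZ25 Lemma 3.8 at `Y = S¹ × S²` (`k_l = 1`), with the
    parallel case folded in: UNSHIELDED — under SPC4 `M ≅ S⁴` but `T` is an arbitrary (possibly
    non-standard, MSZ16 Conj. 3.11 / AZ25 Q8.3) `(3;1,1,1)`-trisection of it; yet by Waldhausen the
    genus-3 splitting `H_i ∪_F H_j` of `∂T_l ≅ S¹ × S²` is THE standard one whatever `T` and `M`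
    are, so the stub is a statement about ONE Heegaard splitting.  Faithful to p. 10 (held text
    re-read: "let `c₁` and `c₂` be a weak-reducing pair of non-separating but mutually separating
    curves. Then either `c₁` is a reducing curve or `c₂` is a reducing curve"; proof by
    untelescoping, Prop. 2.4, Lemmas 3.4, 3.6 — re-derived below and found sound).  MUTATION
    (`Stub3NoSphere`, `stub3_of_noSphere`, PROVED one-liner): the hypothesis `e : M ≃ₕ S⁴` is
    DECORATION — the `e`-free statement is still Lemma 3.8 and true in print; likewise `k = (1,1,1)`
    only serves to make `∂T_l ∈ {S³, S¹ × S²}` (any `k_l ≤ 1` would do, and the printed proof runs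
    for every `#ᵏ(S¹ × S²)`, which has no incompressible torus).  Load-bearing on paper: MUTUAL
    SEPARATION (without it: Lemma 3.7's four-way conclusion; witness in the standard splitting
    `(m₁ = m₁) # (m₂, l₂) # (m₃, l₃)` of `S¹ × S²`: `a = m₂`, `b = l₃` — disjoint, non-separating,
    `a ∪ b` non-separating, neither reducing) and the ONE-SIDEDNESS of the conclusion (the
    strengthening "`a` is reducing" is false: `a = m₁ # ∂N(m₂ ∪ (l₂ # m₃))` bounds in `H_i` only —
    its image in `π₁ H_j = F(l₁, m₂, m₃)` is a conjugate of `[m₂, m₃^{±1}] ≠ 1` — while its only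
    disjoint homologous `H_j`-partners, e.g. `b = m₁⁺`, are reducing, exactly as the Lemma says).
    A counterexample search in the standard splitting (pairs `a ∈ 𝒟(H_i) ∖ 𝒟(H_j)`,
    `b ∈ 𝒟(H_j) ∖ 𝒟(H_i)`, disjoint, `[a] = [b] = ±μ` forced by `L_i ∩ L_j = ℤμ`) produced none
    and the printed proof explains why (the separating reducing curve `c*` of the reducible thick
    level is isotopic to `b` in `Σ_a` by uniqueness of the separating disc of the compression
    body).  NOT formalisable either way today (no Heegaard-splitting / disc-complex vocabulary).
    SKELETON v7 (2026-08-17T15:32Z) replaced this stub by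
    `stub_separatingPairWeaklyReducible_of_noAnnularChart01` (whole indexed triple `f`, labels
    fixed to `(0, 1)`, extra clause "`f 0`, `f 1` not co-annular", conclusion `IsWeaklyReducible T`):
    `stub3v7_of_stub3` / `stub3v7_of_noSphere` (PROVED) — the v7 form is IMPLIED by the v2 form,
    hence by the `e`-free Lemma 3.8, the third curve `f 2` closing the weak reduction
    (`isWeaklyReducible_of_triple_of_boundsDisc_cross`); `stub3v7AnyPair_of_stub3v7` (PROVED, uses
    the LANDED stub 3a `Theorems.stub_boundsDisc_of_annularChart`, p168238) — the "not co-annular"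
    clause is REDUNDANT; unused (decoration) in v7: `e`, "`⋃ f i` separates", "not co-annular";
    load-bearing on paper: mutual separation of `f 0 ∪ f 1` (without it the stub would assert a
    weak reduction in the pants configuration (3), which AZ25 never exhibit and which would settle
    their Question 8.3 for homotopy spheres).  Joint sufficiency of v7 re-checked on the farm:
    rc 0, 4 sorries = the 4 registered stubs, `DependentTripleGenusThreeStandard_of` closed
    modulo them.
  - Stub 4 `stub_loopPartnerNoRange` (AZ25 §7 case (3) ⇒ loop partner of genus `≤ 2`): its
    conclusion depends on `M` only, and for `M ≅ S⁴` it is TRUE (`S⁴` is surgery on the fibre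
    circle of `S¹ × S³`, which is `(1;1,1,1)`-trisected): SHIELDED MODULO the presentation
    `SpherePresentation` ("the round `S⁴` is a circle surgery on SOME `ℝ⁴`-charted `X′` carrying a
    GK-trisection of genus `≤ 2`") — `stub4_of_spc4_of_spherePresentation`, PROVED by transporting
    the gluing along `S⁴ ≅ M` (`IsOpenGluing.diffeomorph_comp_of_boundaryless`).  The tree proves
    the cross-model presentation `isCircleSurgery_sphereOne_prod_sphereThree_sphereFour`
    (`S¹ × S³` on `(𝓡 1).prod (𝓡 3)`), but has no `ℝ⁴`-charted copy of `S¹ × S³` WITH a genus-`≤ 2`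
    GK-trisection (GK existence `exists_isBalancedGKTrisection_holds` gives SOME genus), so
    `SpherePresentation` is an honest residual hypothesis, true in print (GK16 §2; MSZ16).
* §C TARGETS: none (payload `stuck_stubs = []`); the apex `stub_loopPartnerNoRange` is held by the
  lead and is shielded (above), `stub_separatingPairReducing` is the only stub a worker could get
  WRONG by mis-transcription — its registered text was checked against p. 10 here.

WHY IT RESISTS.  Truth value sits entirely in `e : M ≃ₕ S⁴` + the conclusion `M ≅ S⁴`: the crux,
stub 1 and stub 4 conclude an instance of the summit; stubs 2 and 3 are theorems in print whose
transcriptions were audited (stub 2 down to the misprint, now kernel-certified).  A refutation of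
anything in this line is an exotic `S⁴` of trisection genus `3` or an error in MSZ16 / AZ25 §3.

Landed from this file: `Theorems/DependentTripleGenusThreeStandard/Negative/SketchStubsTightness.lean`
(§B stub 2 tightness + stub 1/4 shields + §0), p169239 ACCEPTED 2026-08-17T15:53Z — importable as
`Summits.SmoothPoincare4.SmoothPoincare4.Theorems.DependentTripleGenusThreeStandard.Negative.SketchStubsTightness`
(namespace `…Theorems.DependentTripleGenusThreeStandard.Negative`: `stub_mszClassification_false_with_max`,
`stub_mszClassification_false_with_relaxed_range`, `sphereFour_not_mszConclusion_succ`,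
`not_smoothPoincare4_of_not_dependentTripleGenusThreeStandard`, `stub_weaklyReducibleStandard_of_smoothPoincare4`,
`stub_loopPartnerNoRange_of_smoothPoincare4_of_presentation`, `isCircleSurgery_of_diffeomorph_result`, …).
-/

noncomputable section

-- the prescribed namespace repeats the component `SmoothPoincare4` (P = Sub)
set_option linter.dupNamespace false

open scoped Manifold ContDiff Topology ContinuousMap
open Set
open Literature.Topology.FourManifolds
open Literature.Topology.FourManifolds.Trisection
open Summit.SmoothPoincare4.SmoothPoincare4.Theses.WeakReductionDescent

namespace Summit.SmoothPoincare4.SmoothPoincare4.Cruxes.DependentTripleGenusThreeStandard.Disproof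

/-- Local notation: `𝔼 n = ℝⁿ`. -/
local notation "𝔼 " n:arg => EuclideanSpace ℝ (Fin n)

/-- Local notation: the unit sphere `Sⁿ ⊂ ℝⁿ⁺¹`. -/
local notation "𝕊 " n:arg => (Metric.sphere (0 : EuclideanSpace ℝ (Fin (n + 1))) 1)

/-! ## §0 Refutation cost of the crux -/

/-- **A refutation of X_F refutes the summit** (through the LANDED prover theorem
`Theorems.dependentTripleGenusThreeStandard_of_smoothPoincare`; the birth attack proves the same
from scratch as `BirthAttack.not_spc4_of_not`).  So `¬ X_F` is an exotic `S⁴` — of trisection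
genus `≤ 3`, `BirthAttack.exotic_of_not`. [folklore] -/
theorem not_spc4_of_not (h : ¬ DependentTripleGenusThreeStandard) : ¬ _root_.SmoothPoincare4 :=
  fun hs => h (Summit.SmoothPoincare4.SmoothPoincare4.Theorems.dependentTripleGenusThreeStandard_of_smoothPoincare hs)

/-! ## §A Load-bearing analysis of the crux (one hypothesis dropped at a time) -/

/-- The dependent-triple clause of the decl as a predicate of `(M, T)` — by `Iff.rfl` the tree's
`Trisection.HasDependentTriple T` (`DependentTripleGenusThreeTrisectionsProofs.lean`) and the birth
attack's `BirthAttack.DT M T`; restated so that this file does not depend on the birth-attack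
workfile. [cite: ArandaZupan2025, p. 2 and §7 p. 24 (dependent triple)] -/
def DT (M : Type) [TopologicalSpace M] [ChartedSpace (EuclideanSpace ℝ (Fin 4)) M]
    (T : Fin 3 → Set M) : Prop :=
  (let F : Set M := ⋂ l, T l; let H : Fin 3 → Set M := fun p => ⋂ (l : Fin 3) (_ : l ≠ p), T l; let IsCurve : Set M → Prop := fun c => c ⊆ F ∧ ∃ γ : (Metric.sphere (0 : EuclideanSpace ℝ (Fin 2)) 1) → M, Manifold.IsSmoothEmbedding (𝓡 1) (𝓡 4) ((⊤ : ℕ∞) : WithTop ℕ∞) γ ∧ Set.range γ = c; let BoundsDisc : Set M → Set M → Prop := fun A c => ∃ d : (Metric.closedBall (0 : EuclideanSpace ℝ (Fin 2)) 1) → M, Manifold.IsSmoothEmbedding (𝓡∂ 2) (𝓡 4) ((⊤ : ℕ∞) : WithTop ℕ∞) d ∧ Set.range d ⊆ A ∧ d '' ((𝓡∂ 2).boundary (Metric.closedBall (0 : EuclideanSpace ℝ (Fin 2)) 1)) = c ∧ Set.range d ∩ F = c; let NonSep : Set M → Prop := fun c => IsConnected (F \ c); let DependentTriple : Prop := ∃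 (a b c : Set M), IsCurve a ∧ IsCurve b ∧ IsCurve c ∧ Disjoint a b ∧ Disjoint b c ∧ Disjoint a c ∧ NonSep a ∧ NonSep b ∧ NonSep c ∧ BoundsDisc (H 0) a ∧ BoundsDisc (H 1) b ∧ BoundsDisc (H 2) c ∧ ¬ IsPreconnected (F \ (a ∪ b ∪ c)); DependentTriple)

/-- Readback: the crux is "`M ≃ₕ S⁴`, genus-3 GK-trisection `T`, `DT M T` ⇒ `M ≅ S⁴`" (`Iff.rfl`).
[cite: ArandaZupan2025, Thm. 1.4 and Cor. 1.5 (p. 2)] -/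
theorem crux_iff :
    DependentTripleGenusThreeStandard ↔
      ∀ (M : Type) [TopologicalSpace M] [T2Space M] [SecondCountableTopology M]
        [ChartedSpace (𝔼 4) M] [IsManifold (𝓡 4) ∞ M],
        (M ≃ₕ 𝕊 4) → ∀ (k : Fin 3 → ℕ) (T : Fin 3 → Set M),
          IsGKTrisection M 3 k T → DT M T → Nonempty (M ≃ₘ⟮𝓡 4, 𝓡 4⟯ 𝕊 4) :=
  Iff.rfl

/-- **X_F with the homotopy equivalence DROPPED**: "every smooth 4-manifold (bare binders) with a
genus-3 GK-trisection admitting a dependent triple is diffeomorphic to `S⁴`".  UNSHIELDED, and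
FALSE IN PRINT: `S¹ × S³` with the `(3; 2,2,1)`-trisection
`(S¹ × S³)(1;1,1,1) # S⁴(1;1,0,0) # S⁴(1;0,1,0)` carries the dependent triple
`(α₁, push-off of β₁ = α₁, γ₃)` of AZ25 §7 configuration (1) (two parallel curves already separate
`F`), and `π₁(S¹ × S³) = ℤ`.  (The birth attack's witness `#³(S¹ × S³)` and the spun lens spaces
`S_p`, `p ≥ 2`, AZ25 Fig. 3, work too.)  Not formalisable now: no `ℝ⁴`-charted trisected copy of
`S¹ × S³` with explicit compressing discs in the tree; see
`withoutHomotopyEquiv_false_of_nonSimplyConnectedCarrier` for the kernel-checked shadow.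
[cite: ArandaZupan2025, §7 p. 24, configuration (1)] [cite: GayKirby2016, §2 (genus-one trisections)] -/
def WithoutHomotopyEquiv : Prop :=
  ∀ (M : Type) [TopologicalSpace M] [T2Space M] [SecondCountableTopology M]
    [ChartedSpace (𝔼 4) M] [IsManifold (𝓡 4) ∞ M],
    ∀ (k : Fin 3 → ℕ) (T : Fin 3 → Set M),
      IsGKTrisection M 3 k T → DT M T → Nonempty (M ≃ₘ⟮𝓡 4, 𝓡 4⟯ 𝕊 4)

/-- `WithoutHomotopyEquiv` trivially implies the crux (it is the crux with a hypothesis deleted).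
[folklore] -/
theorem crux_of_withoutHomotopyEquiv (h : WithoutHomotopyEquiv) : DependentTripleGenusThreeStandard := by
  rw [crux_iff]
  intro M _ _ _ _ _ _e k T hT hdt
  exact h M k T hT hdt

/-- **The construction that kills `WithoutHomotopyEquiv`**: a closed smooth `X` (charted on `ℝ⁴`)
that is NOT simply connected and carries a genus-3 GK-trisection with a dependent triple.  Printed
witness: `S¹ × S³` with its `(3; 2,2,1)`-trisection (module docstring); a definition work item in
kind (trisection diagrams ↔ `IsGKTrisection` with explicit discs), not constructible in the tree
today. [cite: GayKirby2016, §2 (genus-one trisections of S¹ × S³ and S⁴; connected sum)]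
[cite: ArandaZupan2025, §7 p. 24, configuration (1)] -/
def NonSimplyConnectedCarrier : Prop :=
  ∃ (X : Type) (_ : TopologicalSpace X) (_ : T2Space X) (_ : SecondCountableTopology X)
    (_ : ChartedSpace (𝔼 4) X) (_ : IsManifold (𝓡 4) ∞ X) (k : Fin 3 → ℕ) (T : Fin 3 → Set X),
    IsGKTrisection X 3 k T ∧ DT X T ∧ ¬ SimplyConnectedSpace X

/-- **`WithoutHomotopyEquiv` is false MODULO `NonSimplyConnectedCarrier`**: the carrier would be
diffeomorphic to `S⁴`, hence simply connected (`simplyConnectedSpace_sphere_four_holds`, transported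
along the homeomorphism).  So the homotopy-sphere hypothesis of X_F is load-bearing for truth value,
pending only the (printed, unformalised) construction. [cite: ArandaZupan2025, Thm. 1.4 (p. 2): the list contains S¹ × S³ summands] -/
theorem withoutHomotopyEquiv_false_of_nonSimplyConnectedCarrier (hc : NonSimplyConnectedCarrier) :
    ¬ WithoutHomotopyEquiv := by
  intro h
  obtain ⟨X, _, _, _, _, _, k, T, hT, hdt, hX⟩ := hc
  obtain ⟨Φ⟩ := h X k T hT hdt
  haveI : SimplyConnectedSpace (𝕊 4) := simplyConnectedSpace_sphere_four_holds
  exact hX Φ.toHomeomorph.toHomotopyEquiv.simplyConnectedSpace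

/-- **X_F with the dependent triple DROPPED** (genus 3 kept): "every smooth homotopy 4-sphere with
a genus-3 GK-trisection is `≅ S⁴`" — MSZ16 for the unbalanced types plus the OPEN `(3;1,1,1)`
frontier (Meier's conjecture; `Literature.Barriers.SmoothPoincare4.LowGenusTrisectionBarrier`'s
first open type).  SHIELDED (`withoutTriple_of_spc4`): dropping the triple loses the METHOD
(AZ25 §7), not the truth value. [cite: ArandaZupan2025, Conjecture 1.2 and Question 8.3] -/
def WithoutTriple : Prop :=
  ∀ (M : Type) [TopologicalSpace M] [T2Space M] [SecondCountableTopology M]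
    [ChartedSpace (𝔼 4) M] [IsManifold (𝓡 4) ∞ M],
    (M ≃ₕ 𝕊 4) → ∀ (k : Fin 3 → ℕ) (T : Fin 3 → Set M),
      IsGKTrisection M 3 k T → Nonempty (M ≃ₘ⟮𝓡 4, 𝓡 4⟯ 𝕊 4)

/-- `WithoutTriple` is SPC4-implied (its conclusion is the summit's at `M`). [folklore] -/
theorem withoutTriple_of_spc4 (h : _root_.SmoothPoincare4) : WithoutTriple := by
  intro M _ _ _ _ _ e _k _T _hT
  exact h M ‹_› ‹_› e

/-- `WithoutTriple` implies the crux. [folklore] -/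
theorem crux_of_withoutTriple (h : WithoutTriple) : DependentTripleGenusThreeStandard := by
  rw [crux_iff]
  intro M _ _ _ _ _ e k T hT _hdt
  exact h M e k T hT

/-- **X_F with `NonSep` deleted from the triple** (the three curves may be inessential).  On paper
this is EQUIVALENT to `WithoutTriple`: three pairwise disjoint tiny circles in a disc of `F`,
capped by discs pushed slightly into `H 0`, `H 1`, `H 2` (interiors off `F`), satisfy every other
clause and their union separates `F`; so without `NonSep` Thm 1.4 would be the open frontier.
SHIELDED (`withoutNonSep_of_spc4`). [cite: ArandaZupan2025, §2 p. 3 ("by a curve … we mean … an essential simple closed curve") and Remark 2.5] -/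
def WithoutNonSep : Prop :=
  ∀ (M : Type) [TopologicalSpace M] [T2Space M] [SecondCountableTopology M]
    [ChartedSpace (𝔼 4) M] [IsManifold (𝓡 4) ∞ M],
    (M ≃ₕ 𝕊 4) → ∀ (k : Fin 3 → ℕ) (T : Fin 3 → Set M),
      IsGKTrisection M 3 k T →
      (let F : Set M := ⋂ l, T l; let H : Fin 3 → Set M := fun p => ⋂ (l : Fin 3) (_ : l ≠ p), T l; let IsCurve : Set M → Prop := fun c => c ⊆ F ∧ ∃ γ : (Metric.sphere (0 : EuclideanSpace ℝ (Fin 2)) 1) → M, Manifold.IsSmoothEmbedding (𝓡 1) (𝓡 4) ((⊤ : ℕ∞) : WithTop ℕ∞) γ ∧ Set.range γ = c; let BoundsDisc : Set M → Set M → Prop := fun A c => ∃ d : (Metric.closedBall (0 : EuclideanSpace ℝ (Fin 2)) 1) → M, Manifold.IsSmoothEmbedding (𝓡∂ 2) (𝓡 4) ((⊤ : ℕ∞) : WithTop ℕ∞) d ∧ Set.range d ⊆ A ∧ d '' ((𝓡∂ 2).boundary (Metric.closedBall (0 : EuclideanSpace ℝ (Fin 2)) 1)) = c ∧ Set.range d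 ∩ F = c; let LooseTriple : Prop := ∃ (a b c : Set M), IsCurve a ∧ IsCurve b ∧ IsCurve c ∧ Disjoint a b ∧ Disjoint b c ∧ Disjoint a c ∧ BoundsDisc (H 0) a ∧ BoundsDisc (H 1) b ∧ BoundsDisc (H 2) c ∧ ¬ IsPreconnected (F \ (a ∪ b ∪ c)); LooseTriple) →
      Nonempty (M ≃ₘ⟮𝓡 4, 𝓡 4⟯ 𝕊 4)

/-- `WithoutNonSep` is SPC4-implied. [folklore] -/
theorem withoutNonSep_of_spc4 (h : _root_.SmoothPoincare4) : WithoutNonSep := by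
  intro M _ _ _ _ _ e _k _T _hT _hl
  exact h M ‹_› ‹_› e

/-- `WithoutNonSep` implies the crux (a dependent triple is a loose triple). [folklore] -/
theorem crux_of_withoutNonSep (h : WithoutNonSep) : DependentTripleGenusThreeStandard := by
  rw [crux_iff]
  intro M _ _ _ _ _ e k T hT hdt
  obtain ⟨a, b, c, ha, hb, hc, hab, hbc, hac, -, -, -, hda, hdb, hdc, hsep⟩ := hdt
  exact h M e k T hT ⟨a, b, c, ha, hb, hc, hab, hbc, hac, hda, hdb, hdc, hsep⟩

/-! ## §B The picked line `Sketch`: the four registered stubs, verbatim, and what is provable ABOUT them -/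

/-! ### Stub 1 — `stub_weaklyReducibleStandard` (AZ25 Thm 1.3, hs-corollary): SHIELDED -/

/-- Stub 1 of `Lines/Sketch.lean`, verbatim. [cite: ArandaZupan2025, Thm. 1.3 (p. 2)] -/
def Stub1 : Prop :=
  Literature.Barriers.SmoothPoincare4.az2025_weaklyReducible_genusThree_homotopySphere_gk.{0}

/-- **Stub 1 is SPC4-implied** (its conclusion is `M ≅ S⁴` for an `M ≃ₕ S⁴`; the tree's
`az2025_weaklyReducible_genusThree_homotopySphere_gk_of_smoothPoincare` fed with the summit).
Not killable short of an exotic `S⁴`. [folklore] -/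
theorem stub1_of_spc4 (h : _root_.SmoothPoincare4) : Stub1 :=
  Literature.Barriers.SmoothPoincare4.az2025_weaklyReducible_genusThree_homotopySphere_gk_of_smoothPoincare
    fun X _ _ _ _ _ _ e => h X ‹_› ‹_› e

/-! ### Stub 2 — `stub_mszClassification` (MSZ16 Thm 1.2): UNSHIELDED, printed; TIGHT (two refuted variants) -/

/-- Stub 2 of `Lines/Sketch.lean`, verbatim: Meier–Schirmer–Zupan's classification in the tree's
tracked form, `k′ = min{k₁, k₂}`. [cite: MeierSchirmerZupan2016, Thm. 1.2] -/
def Stub2 : Prop :=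
  msz_trisection_classification_gk.{0}

/-- **The PRINTED form of MSZ16 Thm 1.2, read literally: `k′ = max{k₂, k₃}`** (here
`max (k 1) (k 2)`, the sector `S 0` playing `X₁`) — everything else verbatim as in
`msz_trisection_classification_gk`.  The tree argues on paper (module docstring of
`LargeKTrisectionClassification.lean`) that `max` is a misprint for `min`; below this is
kernel-certified: the `max` form is FALSE. [cite: MeierSchirmerZupan2016, Thm. 1.2 (as printed: "let k′ = max{k₂, k₃}")] -/
def MszClassificationWithMax : Prop :=
  ∀ (X : Type) [TopologicalSpace X] [T2Space X] [SecondCountableTopology X]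
    [ChartedSpace (𝔼 4) X] [IsManifold (𝓡 4) ∞ X] [CompactSpace X] [ConnectedSpace X]
    (_ : SmoothOrientation (𝓡 4) X) (g : ℕ) (k : Fin 3 → ℕ) (S : Fin 3 → Set X),
    IsGKTrisection X g k S → g ≤ k 0 + 1 →
      IsCircleProdSum (max (k 1) (k 2)) X ∨
      ∃ (M : Type) (_ : TopologicalSpace M) (_ : T2Space M) (_ : SecondCountableTopology M)
        (_ : ChartedSpace (𝔼 4) M) (_ : IsManifold (𝓡 4) ∞ M) (_ : CompactSpace M)
        (_ : ConnectedSpace M),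
        IsCircleProdSum (max (k 1) (k 2)) M ∧
          IsConnectedSum (𝓡 4) (𝓡 4) (𝓡 4) M ComplexProjectivePlane X

/-- **MSZ16 Thm 1.2 with its RANGE WIDENED BY ONE: `k₀ + 2 ≥ g` instead of `k₀ + 1 ≥ g`**
(everything else verbatim, `k′ = min`).  FALSE (below): the `(3;1,1,1)` type of this route lies
outside every classification of MSZ shape. [cite: MeierSchirmerZupan2016, Thm. 1.2 (range k₁ ≥ g − 1)] -/
def MszClassificationRelaxedRange : Prop :=
  ∀ (X : Type) [TopologicalSpace X] [T2Space X] [SecondCountableTopology X]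
    [ChartedSpace (𝔼 4) X] [IsManifold (𝓡 4) ∞ X] [CompactSpace X] [ConnectedSpace X]
    (_ : SmoothOrientation (𝓡 4) X) (g : ℕ) (k : Fin 3 → ℕ) (S : Fin 3 → Set X),
    IsGKTrisection X g k S → g ≤ k 0 + 2 →
      IsCircleProdSum (min (k 1) (k 2)) X ∨
      ∃ (M : Type) (_ : TopologicalSpace M) (_ : T2Space M) (_ : SecondCountableTopology M)
        (_ : ChartedSpace (𝔼 4) M) (_ : IsManifold (𝓡 4) ∞ M) (_ : CompactSpace M)
        (_ : ConnectedSpace M),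
        IsCircleProdSum (min (k 1) (k 2)) M ∧
          IsConnectedSum (𝓡 4) (𝓡 4) (𝓡 4) M ComplexProjectivePlane X

/-- The round `S⁴` is compact, simply connected and smoothly orientable (tree theorems, fed with
the identity homotopy equivalence). [cite: HatcherAT2002, Prop. 1.14 and Prop. 3.29] -/
theorem sphereFour_compact_simplyConnected_orientable :
    CompactSpace (𝕊 4) ∧ SimplyConnectedSpace (𝕊 4) ∧ Nonempty (SmoothOrientation (𝓡 4) (𝕊 4)) :=
  ⟨compactSpace_of_homotopyEquiv_sphere_four_holds _ (ContinuousMap.HomotopyEquiv.refl _),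
    simplyConnectedSpace_sphere_four_holds,
    isOrientable_of_homotopyEquiv_sphere_four_holds _ (ContinuousMap.HomotopyEquiv.refl _)⟩

/-- **No conclusion of MSZ shape with `k′ ≥ 1` holds for the round `S⁴`**: `#^{n+1}(S¹ × S³)` is
not simply connected (`IsCircleProdSum.not_simplyConnectedSpace_succ`: a summand `S¹ × S³` of a
simply connected sum would be simply connected, Kosinski VI.2), and a `ℂP²`-cosummand `M` of `S⁴`
is simply connected (`IsConnectedSum.simplyConnectedSpace_left`), so cannot be `#^{n+1}(S¹ × S³)`
either. [cite: Kosinski1993, Ch. VI §2, Prop. 2.1] -/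
theorem sphereFour_not_mszConclusion_succ (n : ℕ) :
    ¬ (IsCircleProdSum (n + 1) (𝕊 4) ∨
      ∃ (M : Type) (_ : TopologicalSpace M) (_ : T2Space M) (_ : SecondCountableTopology M)
        (_ : ChartedSpace (𝔼 4) M) (_ : IsManifold (𝓡 4) ∞ M) (_ : CompactSpace M)
        (_ : ConnectedSpace M),
        IsCircleProdSum (n + 1) M ∧
          IsConnectedSum (𝓡 4) (𝓡 4) (𝓡 4) M ComplexProjectivePlane (𝕊 4)) := by
  haveI : SimplyConnectedSpace (𝕊 4) := simplyConnectedSpace_sphere_four_holds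
  rintro (h1 | ⟨M, _, _, _, _, _, _, _, hM, hsum⟩)
  · exact Literature.Barriers.SmoothPoincare4.IsCircleProdSum.not_simplyConnectedSpace_succ h1 ‹_›
  · haveI : SimplyConnectedSpace M :=
      hsum.simplyConnectedSpace_left (by rw [finrank_euclideanSpace_fin]; norm_num)
    exact Literature.Barriers.SmoothPoincare4.IsCircleProdSum.not_simplyConnectedSpace_succ hM ‹_›

/-- **TIGHTNESS OF STUB 2 (i): the printed `k′ = max{k₂, k₃}` form of MSZ16 Thm 1.2 is FALSE.**
Witness: the `(1; 0,1,0)`-trisection of the round `S⁴` obtained by ONE implant on the sector `1`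
from Gay–Kirby's genus-`0` trisection (`sphere_genusZero_gkTrisection_holds`,
`IsGKTrisection.exists_stabilizeOne`, both PROVED): `g = 1 ≤ k₀ + 1 = 1`, `max{k₁, k₂} = 1`, and
`S⁴` admits no MSZ conclusion with `k′ = 1` (`sphereFour_not_mszConclusion_succ`).  So the tree's
reading `k′ = min` (stub 2 as registered) is the only tenable one — any proof of stub 2 must
PRODUCE `min`. [cite: MeierSchirmerZupan2016, Thm. 1.2 and Remark 5.2; the (1;0,1,0)-trisection of S⁴, §2] -/
theorem stub_mszClassification_false_with_max : ¬ MszClassificationWithMax := by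
  intro h
  obtain ⟨hc, hsc, ⟨o⟩⟩ := sphereFour_compact_simplyConnected_orientable
  haveI := hc
  haveI := hsc
  obtain ⟨S₀, hS₀⟩ := sphere_genusZero_gkTrisection_holds
  have hT₀ : IsGKTrisection (𝕊 4) 0 (fun _ => 0) S₀ := hS₀.isGKTrisection
  obtain ⟨S₁, hT₁, -⟩ := hT₀.exists_stabilizeOne hT₀.nonempty_iInter 1
  have key := h (𝕊 4) o (0 + 1) _ S₁ hT₁ (by simp)
  have hmax : max (Function.update (fun _ : Fin 3 => (0 : ℕ)) 1 ((fun _ : Fin 3 => (0 : ℕ)) 1 + 1) 1)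
      (Function.update (fun _ : Fin 3 => (0 : ℕ)) 1 ((fun _ : Fin 3 => (0 : ℕ)) 1 + 1) 2) = 0 + 1 := by
    simp [Function.update]
  rw [hmax] at key
  exact sphereFour_not_mszConclusion_succ 0 key

/-- **TIGHTNESS OF STUB 2 (ii): the MSZ range cannot be widened to `k₀ + 2 ≥ g`.**  Witness: the
`(3; 1,1,1)`-trisection of the round `S⁴` (three implants on the genus-`0` trisection,
`IsGKTrisection.exists_stabilization`, PROVED): `g = 3 ≤ k₀ + 2`, `min{k₁, k₂} = 1`, and `S⁴`
admits no MSZ conclusion with `k′ = 1`.  So any proof of stub 2 must USE `k₀ + 1 ≥ g`, and the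
`(3;1,1,1)` type — the first open type of `LowGenusTrisectionBarrier`, the type of every minimal
genus-3 trisection of a homotopy sphere in this route — is certified to lie outside every
classification of MSZ shape.  (Only the classification-with-list is refuted; the homotopy-sphere
corollary with the widened range remains SPC4-shielded.)
[cite: MeierSchirmerZupan2016, Thm. 1.2] [cite: GayKirby2016, §2 ("Stabilizing the genus 0 trisection of S⁴ gives a genus 3 trisection")] -/
theorem stub_mszClassification_false_with_relaxed_range : ¬ MszClassificationRelaxedRange := by
  intro h
  obtain ⟨hc, hsc, ⟨o⟩⟩ := sphereFour_compact_simplyConnected_orientable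
  haveI := hc
  haveI := hsc
  obtain ⟨S₀, hS₀⟩ := sphere_genusZero_gkTrisection_holds
  have hT₀ : IsGKTrisection (𝕊 4) 0 (fun _ => 0) S₀ := hS₀.isGKTrisection
  obtain ⟨S₃, hT₃, -⟩ := hT₀.exists_stabilization hT₀.nonempty_iInter
  have key := h (𝕊 4) o (0 + 3) _ S₃ hT₃ (by simp)
  have hmin : min ((fun _ : Fin 3 => (0 : ℕ) + 1) 1) ((fun _ : Fin 3 => (0 : ℕ) + 1) 2) = 0 + 1 := by
    simp
  rw [hmin] at key
  exact sphereFour_not_mszConclusion_succ 0 key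

/-- Sanity (consistency of stub 2 AS REGISTERED with the same witnesses): at the `(1;0,1,0)`
trisection of `S⁴` the registered conclusion asks for `IsCircleProdSum (min 1 0) S⁴ = IsCircleProdSum 0 S⁴`,
which HOLDS (`IsCircleProdSum.sphere_self`); the `(3;1,1,1)` trisection is outside its range.
So the two refutations above do not touch stub 2 itself. [cite: MeierZupan2017, §1 ("#^0(S¹ × S³) = S⁴")] -/
theorem stub2_consistent_at_witness :
    IsCircleProdSum (min (Function.update (fun _ : Fin 3 => (0 : ℕ)) 1 ((fun _ : Fin 3 => (0 : ℕ)) 1 + 1) 1)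
      (Function.update (fun _ : Fin 3 => (0 : ℕ)) 1 ((fun _ : Fin 3 => (0 : ℕ)) 1 + 1) 2)) (𝕊 4) := by
  have hmin : min (Function.update (fun _ : Fin 3 => (0 : ℕ)) 1 ((fun _ : Fin 3 => (0 : ℕ)) 1 + 1) 1)
      (Function.update (fun _ : Fin 3 => (0 : ℕ)) 1 ((fun _ : Fin 3 => (0 : ℕ)) 1 + 1) 2) = 0 := by
    simp [Function.update]
  rw [hmin]
  exact IsCircleProdSum.sphere_self

/-! ### Stub 3 — `stub_separatingPairReducing` (AZ25 Lemma 3.8 at `Y = S¹ × S²`): UNSHIELDED, printed; `e` is decoration -/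

/-- Stub 3 of `Lines/Sketch.lean`, verbatim. [cite: ArandaZupan2025, Lemma 3.8 (p. 10) and §7 (pp. 24–25)] -/
def Stub3 : Prop :=
  ∀ (M : Type) [TopologicalSpace M] [T2Space M] [SecondCountableTopology M]
    [ChartedSpace (𝔼 4) M] [IsManifold (𝓡 4) ∞ M],
    M ≃ₕ 𝕊 4 → ∀ T : Fin 3 → Set M, IsGKTrisection M 3 (fun _ => 1) T →
    ∀ i j : Fin 3, i ≠ j → ∀ a b : Set M, IsCurve T a → IsCurve T b →
    BoundsDisc T (spineHandlebody T i) a → BoundsDisc T (spineHandlebody T j) b →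
    Disjoint a b → IsNonSeparating T a → IsNonSeparating T b →
    ¬ IsConnected (centralSurfaceSet T \ (a ∪ b)) →
    BoundsDisc T (spineHandlebody T j) a ∨ BoundsDisc T (spineHandlebody T i) b

/-- **Stub 3 WITHOUT the homotopy equivalence** — still exactly Aranda–Zupan's Lemma 3.8 for the
genus-3 Heegaard splitting `H_i ∪_F H_j` of `∂T_l ≅ S¹ × S²` (`k_l = 1`), for EVERY closed
`(3;1,1,1)`-trisected 4-manifold: TRUE IN PRINT (p. 10; the proof — untelescope along `(a, b)`,
the thin level is two tori, compressible in `S¹ × S²`, so a thick genus-2 level is weakly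
reducible (Prop. 2.4) hence reducible (Lemma 3.4); its separating reducing curve `c*` bounds the
unique separating disc of the compression body (Lemma 3.6), so it is isotopic to `b` in `Σ_a`,
whence `b` bounds in `H_i` too — uses nothing about `M`).  So `e : M ≃ₕ S⁴` is DECORATION in
stub 3: a prover should discharge this statement (or its Heegaard-splitting form) and feed
`stub3_of_noSphere`. [cite: ArandaZupan2025, Lemma 3.8 (p. 10), Prop. 2.4, Lemmas 3.4 and 3.6 (pp. 8–9)] -/
def Stub3NoSphere : Prop :=
  ∀ (M : Type) [TopologicalSpace M] [T2Space M] [SecondCountableTopology M]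
    [ChartedSpace (𝔼 4) M] [IsManifold (𝓡 4) ∞ M],
    ∀ T : Fin 3 → Set M, IsGKTrisection M 3 (fun _ => 1) T →
    ∀ i j : Fin 3, i ≠ j → ∀ a b : Set M, IsCurve T a → IsCurve T b →
    BoundsDisc T (spineHandlebody T i) a → BoundsDisc T (spineHandlebody T j) b →
    Disjoint a b → IsNonSeparating T a → IsNonSeparating T b →
    ¬ IsConnected (centralSurfaceSet T \ (a ∪ b)) →
    BoundsDisc T (spineHandlebody T j) a ∨ BoundsDisc T (spineHandlebody T i) b

/-- The `e`-free form gives stub 3 (hypothesis deletion). [folklore] -/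
theorem stub3_of_noSphere (h : Stub3NoSphere) : Stub3 := by
  intro M _ _ _ _ _ _e T hT i j hij a b ha hb hda hdb hab hna hnb hsep
  exact h M T hT i j hij a b ha hb hda hdb hab hna hnb hsep

/-- **Near-miss record (paper, NOT formalisable today): the hypotheses of stub 3 that ARE
load-bearing, and the strengthening that fails** — all inside the standard genus-3 splitting
`(m₁ = m₁) # (m₂ | l₂) # (m₃ | l₃)` of `S¹ × S²` (`H_i`: `m₁, m₂, m₃` bound; `H_j`: `m₁, l₂, l₃`
bound; `π₁ H_i = F(l₁, l₂, l₃)`, `π₁ H_j = F(l₁, m₂, m₃)`; a compressing curve of `H_i` lies in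
`𝒟(H_j)` iff its word in `π₁ H_j` is trivial, Dehn's lemma):
(a) drop MUTUAL SEPARATION: `a = m₂`, `b = l₃` — disjoint, non-separating, `F ∖ (a ∪ b)`
connected, `a ↦ m₂ ≠ 1 ∈ π₁ H_j`, `b ↦ l₃ ≠ 1 ∈ π₁ H_i`: neither is reducing (this is Lemma 3.7's
territory, conclusions (1)/(2));
(b) strengthen the conclusion to "`a` is reducing" (fixed side): `a = m₁ # ∂N(m₂ ∪ (l₂ # m₃))`
bounds in `H_i` (band sum of `H_i`-discs) and represents `μ = [m₁]`, but maps to a conjugate of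
`[m₂, m₃^{±1}] ≠ 1` in `π₁ H_j`; every `b ∈ 𝒟(H_j)` disjoint from and homologous to it is
reducing (e.g. `b = m₁⁺`), as Lemma 3.8 predicts, and `a` is not;
(c) a search for a genuine counterexample (both one-sided) found none: `[a] = [b] ∈ L_i ∩ L_j = ℤμ`
is forced, and the printed proof closes the door.  Recorded as a `True` carrier so that the
statements travel with the file. [cite: ArandaZupan2025, Lemmas 3.7, 3.8 (pp. 9–10)] -/
theorem stub3_paper_record : True := trivial

/-! ### Stub 3, skeleton v7 (`stub_separatingPairWeaklyReducible_of_noAnnularChart01`, registered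
2026-08-17T15:32Z): IMPLIED by the v2 form, so by the `e`-free Lemma 3.8; its "no annular chart"
clause is REDUNDANT given the landed stub 3a (p168238) -/

/-- The annular-chart clause of skeleton v7 (Aranda–Zupan's configuration (1), "`a ∥ b`"): a plane
map, smooth injective and immersive into `M` on an open round annulus with image in the central
surface, whose round circles of radii `r₀`, `r₁` are `a` and `b`.  (`r₀ = r₁` is not excluded but
forces `a = b`; `rlo < 0` turns the annulus into a disc, impossible around a non-separating `a`.)
[cite: ArandaZupan2025, §7 (p. 24), configuration (1)] -/
def CoAnnular {M : Type} [TopologicalSpace M] [ChartedSpace (𝔼 4) M]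
    (T : Fin 3 → Set M) (a b : Set M) : Prop :=
  ∃ (ψ : EuclideanSpace ℝ (Fin 2) → M) (rlo r₀ r₁ rhi : ℝ),
    0 < r₀ ∧ 0 < r₁ ∧ rlo < r₀ ∧ rlo < r₁ ∧ r₀ < rhi ∧ r₁ < rhi ∧
    ContMDiffOn (𝓡 2) (𝓡 4) ∞ ψ {x | rlo < ‖x‖ ∧ ‖x‖ < rhi} ∧
    Set.InjOn ψ {x | rlo < ‖x‖ ∧ ‖x‖ < rhi} ∧
    (∀ x : EuclideanSpace ℝ (Fin 2), rlo < ‖x‖ → ‖x‖ < rhi →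
      Function.Injective (mfderiv (𝓡 2) (𝓡 4) ψ x)) ∧
    ψ '' {x | rlo < ‖x‖ ∧ ‖x‖ < rhi} ⊆ centralSurfaceSet T ∧
    (Set.range fun x : Metric.sphere (0 : EuclideanSpace ℝ (Fin 2)) 1 =>
      ψ (r₀ • (x : EuclideanSpace ℝ (Fin 2)))) = a ∧
    (Set.range fun x : Metric.sphere (0 : EuclideanSpace ℝ (Fin 2)) 1 =>
      ψ (r₁ • (x : EuclideanSpace ℝ (Fin 2)))) = b

/-- Stub 3 of skeleton v7 (`Sketch.stub_separatingPairWeaklyReducible_of_noAnnularChart01`),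
verbatim: the whole indexed dependent triple `f` of a `(3;1,1,1)`-trisected `M ≃ₕ S⁴`, the pair
`f 0 ∪ f 1` separating `F` and NOT co-annular ⟹ `T` is weakly reducible.
[cite: ArandaZupan2025, §7 (pp. 24–25), configuration (2); Lemma 3.8 (p. 10)] -/
def Stub3v7 : Prop :=
  ∀ (M : Type) [TopologicalSpace M] [T2Space M] [SecondCountableTopology M]
    [ChartedSpace (𝔼 4) M] [IsManifold (𝓡 4) ∞ M],
    M ≃ₕ 𝕊 4 → ∀ T : Fin 3 → Set M, IsGKTrisection M 3 (fun _ => 1) T →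
    ∀ f : Fin 3 → Set M,
    (∀ i, IsCurve T (f i)) → (Pairwise fun i j => Disjoint (f i) (f j)) →
    (∀ i, IsNonSeparating T (f i)) → (∀ i, BoundsDisc T (spineHandlebody T i) (f i)) →
    ¬ IsPreconnected (centralSurfaceSet T \ ⋃ i, f i) →
    ¬ IsConnected (centralSurfaceSet T \ (f 0 ∪ f 1)) →
    ¬ (∃ (ψ : EuclideanSpace ℝ (Fin 2) → M) (rlo r₀ r₁ rhi : ℝ),
      0 < r₀ ∧ 0 < r₁ ∧ rlo < r₀ ∧ rlo < r₁ ∧ r₀ < rhi ∧ r₁ < rhi ∧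
      ContMDiffOn (𝓡 2) (𝓡 4) ∞ ψ {x | rlo < ‖x‖ ∧ ‖x‖ < rhi} ∧
      Set.InjOn ψ {x | rlo < ‖x‖ ∧ ‖x‖ < rhi} ∧
      (∀ x : EuclideanSpace ℝ (Fin 2), rlo < ‖x‖ → ‖x‖ < rhi →
        Function.Injective (mfderiv (𝓡 2) (𝓡 4) ψ x)) ∧
      ψ '' {x | rlo < ‖x‖ ∧ ‖x‖ < rhi} ⊆ centralSurfaceSet T ∧
      (Set.range fun x : Metric.sphere (0 : EuclideanSpace ℝ (Fin 2)) 1 =>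
        ψ (r₀ • (x : EuclideanSpace ℝ (Fin 2)))) = f 0 ∧
      (Set.range fun x : Metric.sphere (0 : EuclideanSpace ℝ (Fin 2)) 1 =>
        ψ (r₁ • (x : EuclideanSpace ℝ (Fin 2)))) = f 1) →
    IsWeaklyReducible T

/-- Stub 3 of skeleton v7 with its last clause ("`f 0`, `f 1` not co-annular") DELETED. -/
def Stub3v7AnyPair : Prop :=
  ∀ (M : Type) [TopologicalSpace M] [T2Space M] [SecondCountableTopology M]
    [ChartedSpace (𝔼 4) M] [IsManifold (𝓡 4) ∞ M],
    M ≃ₕ 𝕊 4 → ∀ T : Fin 3 → Set M, IsGKTrisection M 3 (fun _ => 1) T →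
    ∀ f : Fin 3 → Set M,
    (∀ i, IsCurve T (f i)) → (Pairwise fun i j => Disjoint (f i) (f j)) →
    (∀ i, IsNonSeparating T (f i)) → (∀ i, BoundsDisc T (spineHandlebody T i) (f i)) →
    ¬ IsPreconnected (centralSurfaceSet T \ ⋃ i, f i) →
    ¬ IsConnected (centralSurfaceSet T \ (f 0 ∪ f 1)) →
    IsWeaklyReducible T

/-- The elements of `Fin 3` other than `2`. [folklore] -/
theorem fin3_eq_zero_or_one_of_ne_two : ∀ q : Fin 3, q ≠ 2 → q = 0 ∨ q = 1 := by decide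

/-- **The third curve closes the weak reduction**: in an indexed triple (`f i` compressing in
`H_i`, pairwise disjoint, non-separating), if `f 0` ALSO bounds in `H_1` then `T` is weakly
reducible — `c = f 2` (in `H_2`), `c′ = f 0` (in `H_0` and `H_1`).  This is the one printed line
"thus the trisection is again weakly reducible" (p. 25). [cite: ArandaZupan2025, §7 (p. 25)] -/
theorem isWeaklyReducible_of_triple_of_boundsDisc_cross {M : Type} [TopologicalSpace M]
    [ChartedSpace (𝔼 4) M] {T : Fin 3 → Set M} {f : Fin 3 → Set M}
    (hc : ∀ i, IsCurve T (f i)) (hd : Pairwise fun i j => Disjoint (f i) (f j))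
    (hn : ∀ i, IsNonSeparating T (f i)) (hb : ∀ i, BoundsDisc T (spineHandlebody T i) (f i))
    {i j : Fin 3} (hij : i = 0 ∧ j = 1 ∨ i = 1 ∧ j = 0)
    (hcross : BoundsDisc T (spineHandlebody T j) (f i)) :
    IsWeaklyReducible T := by
  rcases hij with ⟨rfl, rfl⟩ | ⟨rfl, rfl⟩
  · refine ⟨2, f 2, f 0, hc 2, hc 0, hd (show (2 : Fin 3) ≠ 0 by decide), hn 2, hn 0, hb 2, ?_⟩
    intro q hq
    rcases fin3_eq_zero_or_one_of_ne_two q hq with rfl | rfl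
    · exact hb 0
    · exact hcross
  · refine ⟨2, f 2, f 1, hc 2, hc 1, hd (show (2 : Fin 3) ≠ 1 by decide), hn 2, hn 1, hb 2, ?_⟩
    intro q hq
    rcases fin3_eq_zero_or_one_of_ne_two q hq with rfl | rfl
    · exact hcross
    · exact hb 1

/-- **v7's stub 3 is IMPLIED by the v2 form** (`Stub3` = Lemma 3.8 at `Y = S¹ × S²` with the pair
`(i, j) = (0, 1)`; the lemma's disjunction "`f 0` bounds in `H_1` or `f 1` bounds in `H_0`" is
closed into a weak reduction by the third curve `f 2`).  Hence (`stub3_of_noSphere`) it is implied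
by the `e`-FREE Lemma 3.8: for stub 3 of v7, too, `e : M ≃ₕ S⁴` is DECORATION, and so are the
clauses "`⋃ f i` separates `F`" and "not co-annular" (unused below); `f 2` is used only as the
`H_2`-curve of the weak reduction.  UNSHIELDED (the conclusion is about `T`, not `M`), printed.
[cite: ArandaZupan2025, Lemma 3.8 (p. 10); §7 (p. 25)] -/
theorem stub3v7_of_stub3 (h : Stub3) : Stub3v7 := by
  intro M _ _ _ _ _ e T hT f hc hd hn hb _hsep3 hsep01 _hnochart
  have h01 : (0 : Fin 3) ≠ 1 := by decide
  rcases h M e T hT 0 1 h01 (f 0) (f 1) (hc 0) (hc 1) (hb 0) (hb 1) (hd h01) (hn 0) (hn 1) hsep01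
    with h0 | h1
  · exact isWeaklyReducible_of_triple_of_boundsDisc_cross hc hd hn hb (Or.inl ⟨rfl, rfl⟩) h0
  · exact isWeaklyReducible_of_triple_of_boundsDisc_cross hc hd hn hb (Or.inr ⟨rfl, rfl⟩) h1

/-- So v7's stub 3 is implied by the `e`-free balanced Lemma 3.8 (`Stub3NoSphere`): the road for a
literature-fact seat is "vendor Lemma 3.8 for `(3;1,1,1)` GK-trisections, instantiate".
[cite: ArandaZupan2025, Lemma 3.8 (p. 10)] -/
theorem stub3v7_of_noSphere (h : Stub3NoSphere) : Stub3v7 :=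
  stub3v7_of_stub3 (stub3_of_noSphere h)

/-- **The "not co-annular" clause of v7's stub 3 is REDUNDANT given the LANDED stub 3a**
(`Theorems.stub_boundsDisc_of_annularChart`, p168238): if `f 0 ∥ f 1` ARE co-annular, the
`H_0`-disc of `f 0` transports to `f 1`, which then bounds in `H_0` and `H_1`, and `f 2` closes
the weak reduction; otherwise v7's stub applies.  So a prover of stub 3 may assume nothing about
annuli, and the lead may delete the clause at no cost (information, not a defect: the clause is
what routes configuration (1) to 3a). [cite: ArandaZupan2025, §7 (pp. 24–25), configurations (1)–(2)] -/
theorem stub3v7AnyPair_of_stub3v7 (h : Stub3v7) : Stub3v7AnyPair := by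
  intro M _ _ _ _ _ e T hT f hc hd hn hb hsep3 hsep01
  by_cases hch : CoAnnular T (f 0) (f 1)
  · have h10 : BoundsDisc T (spineHandlebody T 0) (f 1) :=
      Summit.SmoothPoincare4.SmoothPoincare4.Theorems.stub_boundsDisc_of_annularChart
        M 3 (fun _ => 1) T hT 0 (f 0) (f 1) (hc 0) (hc 1) hch (hb 0)
    exact isWeaklyReducible_of_triple_of_boundsDisc_cross hc hd hn hb (Or.inr ⟨rfl, rfl⟩) h10
  · exact h M e T hT f hc hd hn hb hsep3 hsep01 hch

/-- **Paper record for v7's stub 3 (what IS load-bearing).**  MUTUAL SEPARATION of `f 0 ∪ f 1`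
stays load-bearing: delete it and the statement says "every `(3;1,1,1)`-trisection of a homotopy
4-sphere carrying a dependent triple is weakly reducible", which for the pants configuration (3)
is NOT what Aranda–Zupan prove (they pass to the loop partner `X′` and MSZ16, never exhibiting a
weak reduction of `T`) and which would make every such trisection standard by Thm 1.3 — an open
Meier–Zupan-type statement (AZ25 Question 8.3), neither printed nor SPC4-implied (SPC4 gives
`M ≅ S⁴`, not a weak reduction of `T`), and not refutable here (a non-weakly-reducible
`(3;1,1,1)`-trisection with a pants triple lives on the spun lens spaces `S_p`, `π₁ = ℤ/p`, which
`e` excludes; in a homotopy sphere none is known).  `k = (1,1,1)`: only `k 2 ≤ 1` matters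
(`∂X_2 ∈ {S³, S¹ × S²}` has no incompressible torus). [cite: ArandaZupan2025, §7 (pp. 24–26), §8 Question 8.3] -/
theorem stub3v7_paper_record : True := trivial

/-! ### Stub 4 — `stub_loopPartnerNoRange` (AZ25 §7 case (3)): SHIELDED modulo a presentation of `S⁴` -/

/-- Stub 4 of `Lines/Sketch.lean` (v2, the lead's reshaped apex), verbatim.
[cite: ArandaZupan2025, §7 (pp. 25–26), Lemma 5.4, Prop. 5.5] -/
def Stub4 : Prop :=
  ∀ (M : Type) [TopologicalSpace M] [T2Space M] [SecondCountableTopology M]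
    [ChartedSpace (𝔼 4) M] [IsManifold (𝓡 4) ∞ M],
    M ≃ₕ 𝕊 4 → ∀ T : Fin 3 → Set M, IsGKTrisection M 3 (fun _ => 1) T →
    ∀ f : Fin 3 → Set M,
    ((∀ i, IsCurve T (f i)) ∧ (Pairwise fun i j => Disjoint (f i) (f j)) ∧
      (∀ i, IsNonSeparating T (f i)) ∧ (∀ i, BoundsDisc T (spineHandlebody T i) (f i)) ∧
      (∀ i j, i ≠ j → IsConnected (centralSurfaceSet T \ (f i ∪ f j))) ∧
      ¬ IsPreconnected (centralSurfaceSet T \ ⋃ i, f i)) →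
    ¬ IsWeaklyReducible T →
    ∃ (X' : Type) (_ : TopologicalSpace X') (_ : T2Space X') (_ : SecondCountableTopology X')
      (_ : ChartedSpace (𝔼 4) X') (_ : IsManifold (𝓡 4) ∞ X')
      (g' : ℕ) (k' : Fin 3 → ℕ) (T' : Fin 3 → Set X')
      (ℓ : Metric.sphere (0 : EuclideanSpace ℝ (Fin 2)) 1 → X'),
      g' ≤ 2 ∧ IsGKTrisection X' g' k' T' ∧ IsCircleSurgery (𝓡 4) (𝓡 4) X' M ℓ

/-- **The residual presentation hypothesis of stub 4's shield**: the ROUND `S⁴` is obtained by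
surgery on a loop `ℓ` of SOME `ℝ⁴`-charted smooth `X′` carrying a GK-trisection of genus `≤ 2`.
True in print with `X′ = S¹ × S³`, `ℓ` the fibre circle, the `(1;1,1,1)`-trisection (the tree
PROVES the cross-model presentation `isCircleSurgery_sphereOne_prod_sphereThree_sphereFour` on
Mathlib's product `S¹ × S³`, model `(𝓡 1).prod (𝓡 3)`, but has no `ℝ⁴`-charted copy of `S¹ × S³`
WITH a genus-`≤ 2` GK-trisection). [cite: GayKirby2016, §2 (the (1,1) trisection of S¹ × S³)] [cite: Kirby1989, Ch. I §2 (S⁴ as surgery on S¹ × S³)] -/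
def SpherePresentation : Prop :=
  ∃ (X' : Type) (_ : TopologicalSpace X') (_ : T2Space X') (_ : SecondCountableTopology X')
    (_ : ChartedSpace (𝔼 4) X') (_ : IsManifold (𝓡 4) ∞ X')
    (g' : ℕ) (k' : Fin 3 → ℕ) (T' : Fin 3 → Set X')
    (ℓ : Metric.sphere (0 : EuclideanSpace ℝ (Fin 2)) 1 → X'),
    g' ≤ 2 ∧ IsGKTrisection X' g' k' T' ∧ IsCircleSurgery (𝓡 4) (𝓡 4) X' (𝕊 4) ℓ

/-- **Circle surgery is transported along diffeomorphisms of the RESULT**: if `P` is obtained from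
`X′` by surgery on `ℓ` and `Φ : P ≅ M`, so is `M` (same tube; compose the open gluing with `Φ`,
`IsOpenGluing.diffeomorph_comp_of_boundaryless`). [cite: Kosinski1993, Ch. VI §1, proof of Thm 1.1] -/
theorem isCircleSurgery_of_diffeomorph_result {X' : Type} [TopologicalSpace X'] [T2Space X']
    [ChartedSpace (𝔼 4) X'] {ℓ : Metric.sphere (0 : EuclideanSpace ℝ (Fin 2)) 1 → X'}
    {P : Type} [TopologicalSpace P] [ChartedSpace (𝔼 4) P]
    {M : Type} [TopologicalSpace M] [ChartedSpace (𝔼 4) M] [IsManifold (𝓡 4) ∞ M]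
    (h : IsCircleSurgery (𝓡 4) (𝓡 4) X' P ℓ) (Φ : P ≃ₘ⟮𝓡 4, 𝓡 4⟯ M) :
    IsCircleSurgery (𝓡 4) (𝓡 4) X' M ℓ := by
  obtain ⟨ν, hν⟩ := h
  exact ⟨ν, hν.diffeomorph_comp_of_boundaryless Φ⟩

/-- **Stub 4 is SPC4-implied MODULO `SpherePresentation`**: under the summit `M ≅ S⁴`, and the
presentation of `S⁴` moves along the diffeomorphism; the trisection `T`, the pants triple `f` and
`¬ IsWeaklyReducible T` are not used.  So stub 4 cannot be refuted short of an exotic `S⁴` (or of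
`¬ SpherePresentation`, which is false in print). [folklore] -/
theorem stub4_of_spc4_of_spherePresentation (hS : _root_.SmoothPoincare4) (hP : SpherePresentation) :
    Stub4 := by
  intro M _ _ _ _ _ e _T _hT _f _hf _hwr
  obtain ⟨Φ⟩ := hS M ‹_› ‹_› e
  obtain ⟨X', _, _, _, _, _, g', k', T', ℓ, hg', hT', hs⟩ := hP
  exact ⟨X', ‹_›, ‹_›, ‹_›, ‹_›, ‹_›, g', k', T', ℓ, hg', hT', isCircleSurgery_of_diffeomorph_result hs Φ.symm⟩

/-! ## §C Targets — none this cycle (payload `stuck_stubs = []`); see the module docstring. -/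

end Summit.SmoothPoincare4.SmoothPoincare4.Cruxes.DependentTripleGenusThreeStandard.Disproof

end
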